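import Literature.NumberTheory.DiophantineApproximation.RhinViolaMobiusResidue
import Mathlib.Analysis.Calculus.ParametricIntervalIntegral
import Mathlib.Analysis.Calculus.Deriv.ZPow
import Mathlib.Topology.MetricSpace.HausdorffDistance
import HarnessLib

/-!
# `J_Z^{(1)}` as a holomorphic function of the complex parameter `Z`

Topic `Literature/NumberTheory/DiophantineApproximation`. DEFINITIONS (`RhinViola.resXZc`, `ViolaZudilin.J₁c`,
`ViolaZudilin.seg01`) with proved API; no named facts.

`J₁c Z h j k l m q = (−1)^{l+N+1} ∫₀¹ ξ^j(1−ξ)^h · resXZc (l+q+1) (n+1) (X^k(1−X)^N) ξ Z dξ` is Viola–Zudilin's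
`J_Z^{(1)}` ((2.11), in the Hasse form of `RhinViola.J₁_eq_integral_resXZ`) for a COMPLEX `Z` off the segment
`[0,1]`: `resXZc` is `resXZ` with a complex pole `Z`.

* `J₁c_ofReal` — at real `Z = z > 1` it is the tree's `J₁ z h j k l m q`;
* `hasDerivAt_integral_mul_sub_zpow` — `Z ↦ ∫₀¹ φ(x)(x−Z)^{−e} dx` is holomorphic off `[0,1]` (differentiation under
  the integral sign, the derivative being dominated on a ball at positive distance from `[0,1]`);
* `differentiableAt_J₁c` — `J₁c` is holomorphic on `ℂ ∖ [0,1]` (VZ §2.2: "(2.11) is a one-valued analytic function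
  of `Z`, holomorphic in the open part of `ℂ` not enclosed by `Γ_{0,1}`"; the Hasse form makes this elementary).

## References

* C. Viola, W. Zudilin, J. reine angew. Math. 736 (2018) 193–223, (2.11) and §2.2. [ViolaZudilin2018]
-/

noncomputable section

namespace Literature.NumberTheory.DiophantineApproximation

open Finset Polynomial MeasureTheory intervalIntegral Metric Complex

namespace RhinViola

/-- `resXZ` with a complex pole `Z`: the residue at `η = x` of `P(η)dη/((η−Z)^s (η−x)^a)`.
[cite: ViolaZudilin2018, (2.11)] -/
def resXZc (s a : ℕ) (P : ℝ[X]) (x : ℝ) (Z : ℂ) : ℂ :=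
  ∑ i ∈ range a, (((hasseDeriv i P).eval x : ℝ) : ℂ) *
    ((-1) ^ (a - 1 - i) * ((s + (a - 1 - i) - 1).choose (a - 1 - i) : ℂ) *
      ((x : ℂ) - Z) ^ (-((s : ℤ) + ((a - 1 - i : ℕ) : ℤ))))

/-- At a real pole `resXZc` is `resXZ`. [folklore] -/
theorem resXZc_ofReal (s a : ℕ) (P : ℝ[X]) (x z : ℝ) : resXZc s a P x (z : ℂ) = (resXZ s a P x z : ℂ) := by
  rw [resXZc, resXZ, Complex.ofReal_sum]
  refine sum_congr rfl fun i _ => ?_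
  push_cast
  ring

end RhinViola

namespace ViolaZudilin

open RhinViola (resXZ resXZc resXZc_ofReal J₁_eq_integral_resXZ)

/-- The segment `[0,1] ⊂ ℂ`. [folklore] -/
def seg01 : Set ℂ := (fun t : ℝ => (t : ℂ)) '' Set.Icc 0 1

/-- `[0,1] ⊂ ℂ` is closed. [folklore] -/
theorem isClosed_seg01 : IsClosed seg01 :=
  ((isCompact_Icc : IsCompact (Set.Icc (0 : ℝ) 1)).image continuous_ofReal).isClosed

/-- `[0,1] ⊂ ℂ` is nonempty. [folklore] -/
theorem seg01_nonempty : seg01.Nonempty := ⟨0, 0, by simp⟩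

/-- Off the segment every point of `[0,1]` is at distance `≥ infDist`. [folklore] -/
theorem infDist_le_norm_sub {Z : ℂ} {t : ℝ} (ht : t ∈ Set.Icc (0 : ℝ) 1) : infDist Z seg01 ≤ ‖(t : ℂ) - Z‖ := by
  rw [← dist_eq_norm, dist_comm]
  exact infDist_le_dist_of_mem ⟨t, ht, rfl⟩

/-- **`J_Z^{(1)}` for complex `Z`** (the Hasse form of VZ (2.11)). [cite: ViolaZudilin2018, (2.11)] -/
def J₁c (Z : ℂ) (h j k l m q : ℕ) : ℂ :=
  (-1) ^ (l + (j + q - m) + 1) * ∫ x in (0 : ℝ)..1, ((x ^ j * (1 - x) ^ h : ℝ) : ℂ) *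
    resXZc (l + q + 1) (j + k - m + 1) ((X : ℝ[X]) ^ k * (1 - X) ^ (j + q - m)) x Z

/-- At real `z > 1`, `J₁c z = J₁ z` (`m ≤ j+k`, `m ≤ j+q`). [cite: ViolaZudilin2018, (2.11)] -/
theorem J₁c_ofReal {z : ℝ} (hz : 1 < z) {j k m q : ℕ} (hm : m ≤ j + k) (hq : m ≤ j + q) (h l : ℕ) :
    J₁c (z : ℂ) h j k l m q = (J₁ z h j k l m q : ℂ) := by
  rw [J₁_eq_integral_resXZ hz hm hq h l, J₁c, Complex.ofReal_mul, ← intervalIntegral.integral_ofReal]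
  push_cast
  congr 1
  refine intervalIntegral.integral_congr fun x _ => ?_
  simp only [resXZc_ofReal]

/-! ### Differentiation under the integral sign -/

/-- `Z ↦ (x − Z)^{−e}` has derivative `e (x−Z)^{−e−1}` at `Z ≠ x`. [folklore] -/
theorem hasDerivAt_sub_zpow_neg (x : ℝ) (e : ℕ) {Z : ℂ} (hZ : (x : ℂ) - Z ≠ 0) :
    HasDerivAt (fun W : ℂ => ((x : ℂ) - W) ^ (-(e : ℤ))) ((e : ℂ) * ((x : ℂ) - Z) ^ (-(e : ℤ) - 1)) Z := by
  have h1 : HasDerivAt (fun W : ℂ => (x : ℂ) - W) (-1) Z := by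
    simpa using (hasDerivAt_id Z).const_sub (x : ℂ)
  have h2 : HasDerivAt (fun W : ℂ => ((x : ℂ) - W) ^ (-(e : ℤ))) ((((-(e : ℤ) : ℤ) : ℂ)) * ((x : ℂ) - Z) ^ (-(e : ℤ) - 1) * -1) Z :=
    (hasDerivAt_zpow (-(e : ℤ)) ((x : ℂ) - Z) (Or.inl hZ)).comp Z h1
  refine h2.congr_deriv ?_
  push_cast
  ring

/-- **Holomorphy of `Z ↦ ∫₀¹ φ(x)(x−Z)^{−e} dx` off `[0,1]`** (differentiation under the integral sign).
[cite: ViolaZudilin2018, §2.2] -/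
theorem hasDerivAt_integral_mul_sub_zpow {φ : ℝ → ℂ} (hφ : ContinuousOn φ (Set.Icc 0 1)) (e : ℕ) {Z : ℂ}
    (hZ : Z ∉ seg01) :
    HasDerivAt (fun W : ℂ => ∫ x in (0 : ℝ)..1, φ x * ((x : ℂ) - W) ^ (-(e : ℤ)))
      (∫ x in (0 : ℝ)..1, φ x * ((e : ℂ) * ((x : ℂ) - Z) ^ (-(e : ℤ) - 1))) Z := by
  set δ := infDist Z seg01 with hδ
  have hδpos : 0 < δ := (isClosed_seg01.notMem_iff_infDist_pos seg01_nonempty).1 hZ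
  -- on the ball of radius `δ/2` the points of `[0,1]` stay `δ/2` away
  have hfar : ∀ W ∈ ball Z (δ / 2), ∀ t ∈ Set.Icc (0 : ℝ) 1, δ / 2 ≤ ‖(t : ℂ) - W‖ := by
    intro W hW t ht
    have h1 := infDist_le_norm_sub (Z := Z) ht
    have h2 : ‖(t : ℂ) - Z‖ ≤ ‖(t : ℂ) - W‖ + ‖W - Z‖ := by
      simpa using norm_sub_le_norm_sub_add_norm_sub (t : ℂ) W Z
    rw [mem_ball, dist_eq_norm] at hW
    linarith
  obtain ⟨M, hM⟩ := (isCompact_Icc.image_of_continuousOn hφ).isBounded.exists_norm_le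
  have hMφ : ∀ t ∈ Set.Icc (0 : ℝ) 1, ‖φ t‖ ≤ M := fun t ht => hM _ ⟨t, ht, rfl⟩
  have hcontF : ∀ W ∈ ball Z (δ / 2), ContinuousOn (fun x : ℝ => φ x * ((x : ℂ) - W) ^ (-(e : ℤ))) (Set.Icc 0 1) := by
    intro W hW
    refine hφ.mul (ContinuousOn.zpow₀ (by fun_prop) _ fun t ht => Or.inl ?_)
    exact norm_pos_iff.1 (lt_of_lt_of_le (by positivity) (hfar W hW t ht))
  have hcontF' : ∀ W ∈ ball Z (δ / 2),
      ContinuousOn (fun x : ℝ => φ x * ((e : ℂ) * ((x : ℂ) - W) ^ (-(e : ℤ) - 1))) (Set.Icc 0 1) := by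
    intro W hW
    refine hφ.mul (continuousOn_const.mul (ContinuousOn.zpow₀ (by fun_prop) _ fun t ht => Or.inl ?_))
    exact norm_pos_iff.1 (lt_of_lt_of_le (by positivity) (hfar W hW t ht))
  have hZmem : Z ∈ ball Z (δ / 2) := mem_ball_self (by positivity)
  have hΙ : Set.uIoc (0 : ℝ) 1 = Set.Ioc 0 1 := Set.uIoc_of_le zero_le_one
  have hball : ball Z (δ / 2) ∈ nhds Z := ball_mem_nhds Z (half_pos hδpos)
  have hM0 : 0 ≤ M := le_trans (norm_nonneg _) (hMφ 0 ⟨le_rfl, zero_le_one⟩)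
  refine (intervalIntegral.hasDerivAt_integral_of_dominated_loc_of_deriv_le (𝕜 := ℂ) (μ := volume) (a := 0) (b := 1)
    (F := fun W x => φ x * ((x : ℂ) - W) ^ (-(e : ℤ)))
    (F' := fun W x => φ x * ((e : ℂ) * ((x : ℂ) - W) ^ (-(e : ℤ) - 1)))
    (bound := fun _ => M * (e * (δ / 2) ^ (-(e : ℤ) - 1))) hball ?_ ?_ ?_ ?_ ?_ ?_).2
  · filter_upwards [hball] with W hW
    rw [hΙ]
    exact ((hcontF W hW).mono Set.Ioc_subset_Icc_self).aestronglyMeasurable measurableSet_Ioc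
  · exact ((hcontF Z hZmem).intervalIntegrable_of_Icc zero_le_one)
  · rw [hΙ]
    exact ((hcontF' Z hZmem).mono Set.Ioc_subset_Icc_self).aestronglyMeasurable measurableSet_Ioc
  · refine Filter.Eventually.of_forall fun t ht W hW => ?_
    rw [hΙ] at ht
    have ht' : t ∈ Set.Icc (0 : ℝ) 1 := Set.Ioc_subset_Icc_self ht
    have hd := hfar W hW t ht'
    have hpos : 0 < ‖(t : ℂ) - W‖ := lt_of_lt_of_le (by positivity) hd
    have hz : ‖(t : ℂ) - W‖ ^ (-(e : ℤ) - 1) ≤ (δ / 2) ^ (-(e : ℤ) - 1) := by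
      rw [show (-(e : ℤ) - 1) = -((e + 1 : ℕ) : ℤ) by push_cast; ring, zpow_neg, zpow_neg, zpow_natCast, zpow_natCast]
      exact inv_anti₀ (by positivity) (pow_le_pow_left₀ (by positivity) hd _)
    rw [norm_mul, norm_mul, Complex.norm_natCast, norm_zpow]
    exact mul_le_mul (hMφ t ht') (mul_le_mul_of_nonneg_left hz (by positivity)) (by positivity) hM0
  · exact intervalIntegrable_const
  · refine Filter.Eventually.of_forall fun t ht W hW => ?_
    rw [hΙ] at ht
    have hd := hfar W hW t (Set.Ioc_subset_Icc_self ht)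
    have hne : (t : ℂ) - W ≠ 0 := norm_pos_iff.1 (lt_of_lt_of_le (by positivity) hd)
    exact (hasDerivAt_sub_zpow_neg t e hne).const_mul (φ t)

/-- `J₁c` as a finite sum of integrals `∫₀¹ φ_i(x)(x−Z)^{−e_i}dx`. [cite: ViolaZudilin2018, (2.11)] -/
theorem J₁c_eq_sum (Z : ℂ) (hZ : Z ∉ seg01) (h j k l m q : ℕ) :
    J₁c Z h j k l m q = (-1) ^ (l + (j + q - m) + 1) * ∑ i ∈ range (j + k - m + 1),
      ((-1) ^ (j + k - m + 1 - 1 - i) * (((l + q + 1) + (j + k - m + 1 - 1 - i) - 1).choose (j + k - m + 1 - 1 - i) : ℂ)) *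
      ∫ x in (0 : ℝ)..1, (((x ^ j * (1 - x) ^ h *
          (hasseDeriv i ((X : ℝ[X]) ^ k * (1 - X) ^ (j + q - m))).eval x : ℝ) : ℂ)) *
        ((x : ℂ) - Z) ^ (-(((l + q + 1 : ℕ) : ℤ) + ((j + k - m + 1 - 1 - i : ℕ) : ℤ))) := by
  rw [J₁c]
  congr 1
  have hδpos : 0 < infDist Z seg01 := (isClosed_seg01.notMem_iff_infDist_pos seg01_nonempty).1 hZ
  have hne : ∀ t ∈ Set.Icc (0 : ℝ) 1, (t : ℂ) - Z ≠ 0 := fun t ht =>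
    norm_pos_iff.1 (lt_of_lt_of_le hδpos (infDist_le_norm_sub ht))
  set c : ℕ → ℂ := fun i => (-1) ^ (j + k - m + 1 - 1 - i) *
    (((l + q + 1) + (j + k - m + 1 - 1 - i) - 1).choose (j + k - m + 1 - 1 - i) : ℂ) with hc
  set B : ℕ → ℝ → ℂ := fun i x => (((x ^ j * (1 - x) ^ h *
    (hasseDeriv i ((X : ℝ[X]) ^ k * (1 - X) ^ (j + q - m))).eval x : ℝ) : ℂ)) *
      ((x : ℂ) - Z) ^ (-(((l + q + 1 : ℕ) : ℤ) + ((j + k - m + 1 - 1 - i : ℕ) : ℤ))) with hB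
  have hint : ∀ i ∈ range (j + k - m + 1), IntervalIntegrable (fun x => c i * B i x) volume 0 1 := by
    intro i _
    refine ContinuousOn.intervalIntegrable_of_Icc zero_le_one (continuousOn_const.mul ?_)
    exact ContinuousOn.mul (by fun_prop) (ContinuousOn.zpow₀ (by fun_prop) _ fun t ht => Or.inl (hne t ht))
  calc ∫ x in (0 : ℝ)..1, ((x ^ j * (1 - x) ^ h : ℝ) : ℂ) *
        resXZc (l + q + 1) (j + k - m + 1) ((X : ℝ[X]) ^ k * (1 - X) ^ (j + q - m)) x Z
      = ∫ x in (0 : ℝ)..1, ∑ i ∈ range (j + k - m + 1), c i * B i x := by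
        refine intervalIntegral.integral_congr fun x _ => ?_
        simp only [resXZc, mul_sum, hc, hB]
        refine sum_congr rfl fun i _ => ?_
        push_cast
        ring
    _ = ∑ i ∈ range (j + k - m + 1), ∫ x in (0 : ℝ)..1, c i * B i x := intervalIntegral.integral_finsetSum hint
    _ = _ := sum_congr rfl fun i _ => intervalIntegral.integral_const_mul _ _

/-- **`J₁c` is holomorphic off `[0,1]`.** [cite: ViolaZudilin2018, §2.2] -/
theorem differentiableAt_J₁c {Z : ℂ} (hZ : Z ∉ seg01) (h j k l m q : ℕ) :
    DifferentiableAt ℂ (fun W => J₁c W h j k l m q) Z := by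
  have hopen : IsOpen seg01ᶜ := isClosed_seg01.isOpen_compl
  have hev : (fun W => J₁c W h j k l m q) =ᶠ[nhds Z] fun W => (-1) ^ (l + (j + q - m) + 1) *
      ∑ i ∈ range (j + k - m + 1),
      ((-1) ^ (j + k - m + 1 - 1 - i) * (((l + q + 1) + (j + k - m + 1 - 1 - i) - 1).choose (j + k - m + 1 - 1 - i) : ℂ)) *
      ∫ x in (0 : ℝ)..1, (((x ^ j * (1 - x) ^ h *
          (hasseDeriv i ((X : ℝ[X]) ^ k * (1 - X) ^ (j + q - m))).eval x : ℝ) : ℂ)) *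
        ((x : ℂ) - W) ^ (-(((l + q + 1 : ℕ) : ℤ) + ((j + k - m + 1 - 1 - i : ℕ) : ℤ))) := by
    filter_upwards [hopen.mem_nhds hZ] with W hW
    exact J₁c_eq_sum W hW h j k l m q
  refine DifferentiableAt.congr_of_eventuallyEq ?_ hev
  refine (DifferentiableAt.const_mul (DifferentiableAt.fun_sum fun i _ => DifferentiableAt.const_mul ?_ _) _)
  have hφ : ContinuousOn (fun x : ℝ => (((x ^ j * (1 - x) ^ h *
      (hasseDeriv i ((X : ℝ[X]) ^ k * (1 - X) ^ (j + q - m))).eval x : ℝ) : ℂ))) (Set.Icc 0 1) := by fun_prop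
  have := hasDerivAt_integral_mul_sub_zpow hφ ((l + q + 1) + (j + k - m + 1 - 1 - i)) hZ
  rw [show (((l + q + 1 : ℕ) : ℤ) + ((j + k - m + 1 - 1 - i : ℕ) : ℤ)) = (((l + q + 1) + (j + k - m + 1 - 1 - i) : ℕ) : ℤ) by
    push_cast; ring]
  exact this.differentiableAt

end ViolaZudilin

end Literature.NumberTheory.DiophantineApproximation

end
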